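import Literature.NumberTheory.LFunctions.ThetaChainFreeCheck
import HarnessLib

/-!
# Schoenfeld's `θ`-bound on `[599, 10⁸]` by kernel computation: data-free run, chunk 22 of 35

Topic: `Literature/NumberTheory/LFunctions`. Pure proof file (a kernel computation; nothing is
asserted, no definition). The theorems below evaluate `ThetaChain.runFree` — together `150000`
data-free steps of the certified `θ`-chain (`ThetaChain.stepFree`, `ThetaChainFreeCheck.lean`: the
next prime found and certified by two gcds with the primorials of the odd primes `≤ 2999` and in
`(2999, 10007]`, the enclosures of `log p` and `θ(p)`, and the two comparisons behind
`|θ(x) − x| ≤ √x log² x/(8π)`) — from the state at the prime `63287621` to the state at the prime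
`65985989`. Soundness: `ThetaChain.runFree_sound`; assembly of the 35 chunks: `ThetaUpTo1e8.lean`.
The expected states were obtained by evaluating a twin of the same function outside the kernel
(validated bit-for-bit on the tree's chunk `ThetaChainRun.xrun14`). Declarations of `5·10⁴` steps
(about `70 s` of kernel time each; the kernel's evaluation is linear within a declaration of this size),
`decide +kernel`, standard axioms only (`maxHeartbeats 0` lifts the deterministic time-out).

## References

* L. Schoenfeld, *Sharper bounds for the Chebyshev functions θ(x) and ψ(x). II*, Math. Comp. 30
  (1976), 337–360, Thm. 10 (6.3). [Schoenfeld1976]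
* J. B. Rosser, L. Schoenfeld, *Approximate formulas for some functions of prime numbers*,
  Illinois J. Math. 6 (1962), 64–94, Thms. 18–19 (`θ`-tables to `10⁸`). [RosserSchoenfeld1962]
-/

namespace Literature.NumberTheory.LFunctions.ThetaChainRun

open ThetaChain

set_option maxHeartbeats 0 in
/-- **Data-free certified `θ`-run, chunk 22a** (steps `3150001`–`3200000` after `8886113`: 50000 primes,
`63287621` to `64184833`). [cite: Schoenfeld1976, Thm. 10 (6.3)] -/
theorem frun22a :
    runFree 50000
      ⟨63287621, 21716176654245090775910200, 21716176654245566457244372, 76497964706954146062337160008276, 76497964706955927514741119999650⟩ =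
    some ⟨64184833, 21733194929651602631688064, 21733194929652078313973111, 77584199961329617766615231307314, 77584199961331423003109672181548⟩ := by
  decide +kernel

set_option maxHeartbeats 0 in
/-- **Data-free certified `θ`-run, chunk 22b** (steps `3200001`–`3250000` after `8886113`: 50000 primes,
`64184833` to `65085767`). [cite: Schoenfeld1976, Thm. 10 (6.3)] -/
theorem frun22b :
    runFree 50000
      ⟨64184833, 21733194929651602631688064, 21733194929652078313973111, 77584199961329617766615231307314, 77584199961331423003109672181548⟩ =
    some ⟨65085767, 21750046093166978467504097, 21750046093167454150740084, 78671281825942111077636163322681, 78671281825943940098268631217490⟩ := by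
  decide +kernel

set_option maxHeartbeats 0 in
/-- **Data-free certified `θ`-run, chunk 22c** (steps `3250001`–`3300000` after `8886113`: 50000 primes,
`65085767` to `65985989`). [cite: Schoenfeld1976, Thm. 10 (6.3)] -/
theorem frun22c :
    runFree 50000
      ⟨65085767, 21750046093166978467504097, 21750046093167454150740084, 78671281825942111077636163322681, 78671281825943940098268631217490⟩ =
    some ⟨65985989, 21766652550045374798108279, 21766652550045850482295051, 79759200810049714044256580773868, 79759200810051566849074619528872⟩ := by
  decide +kernel

end Literature.NumberTheory.LFunctions.ThetaChainRun
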